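import Literature.ComputerArithmetic.Shewchuk1997.Compress
import Mathlib.Tactic.Linarith
import Mathlib.Tactic.Positivity
import Mathlib.Tactic.Ring
import Mathlib.Tactic.NormNum
import Mathlib.Tactic.FieldSimp

/-!
# The relative reading holds whenever the top IS the rounded sum — every tie rule; in particular
# for every incompressible two-component expansion (new work)

New work of the certified-arithmetic venture (ENGINES group: shared numerical engines serving
client cells; rigour lives in the verifiers; every published number belongs to a client cell's
ledger, not to the engines group).  Line: the error of the largest component of COMPRESS
[Shewchuk1997, §2.7 Theorem 23 and the conjecture on p. 333].

The RELATIVE reading `|Σ e − hₙ| < 2^-p·|Σ e|` of Shewchuk's p.333 conjecture is false for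
round-to-nearest with ties-to-away (`CompressRelativeErrorTiesAway*.lean`: incompressible
FOUR-component expansions with relative error `> 2^-p`, every precision) and open for round-to-even.
THIS FILE is the positive side at the other end, valid for EVERY round-to-nearest map (any tie
rule) and every precision `p ≥ 1`:

* `abs_sub_fl_lt_two_pow_inv_mul_abs` — if `s ≠ 0` lies on the grid `2^emin·ℤ` (e.g. any finite sum
  of floats) then `|s − fl s| < 2^-p·|s|` STRICTLY.  The textbook bound is `≤ ulp(s)/2 ≤ 2^-p·|s|`
  [BoldoEtAl2023, §2.1–2.2]; equality would force `|s|` to be a power of two carrying a half-ulp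
  error, but a power of two is a float and is rounded to itself.  Below the normal range the error is
  a multiple of `2^emin` of magnitude `≤ 2^emin/2`, hence zero.
* `rel_lt_of_fl_add_eq` — hence for floats `L`, `t` with `fl(L + t) = L` (the larger ABSORBS the
  smaller) and `L + t ≠ 0`: `|(L + t) − L| < 2^-p·|L + t|`.
* `compress_pair_eq_self_iff` — for floats `|t| ≤ |L|`: `compress fl [t, L] = [t, L]` iff
  `fl(L + t) = L ∧ t ≠ 0` (replay COMPRESS; FAST-TWO-SUM is exact, Theorem 6); hence
  `compress_pair_fixed_rel_lt` — every incompressible two-component expansion satisfies the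
  relative reading.

So a counterexample to the relative reading under ANY tie rule needs at least three components; the
known ones (ties-to-away) use four.  HONEST FRAMING: nothing here decides the three-component case or
the round-to-even conjecture; `p`, `emin` are parameters (binary64 is `p = 53`).
-/

namespace Summit.Ventures.CertifiedArithmetic.Expansions

open Literature.ComputerArithmetic.JeannerodRump2018
open Literature.ComputerArithmetic.BoldoJeannerodMelquiondMuller2023 hiding twoSum twoSum_fst
open Literature.ComputerArithmetic.Shewchuk1997

variable {p : ℕ} {emin : ℤ} {fl : ℚ → ℚ}

/-- **Correct rounding has relative error STRICTLY below `2^-p` on the float grid.**  For any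
round-to-nearest `fl` on `F(p, emin)` (`p ≥ 1`, any tie rule) and any `s ≠ 0` that is an integer
multiple of `2^emin` (e.g. a sum of floats): `|s − fl s| < 2^-p·|s|`.  Normal range:
`|s − fl s| ≤ ulp(s)/2 ≤ |s|/2^p`, and equality would make `|s| = 2^(p−1)·ulp(s)` a float with a
nonzero rounding error — impossible.  Subnormal range: the error is a multiple of `2^emin = ulp(s)` of
size `≤ ulp(s)/2`, hence `0`. [cite: BoldoEtAl2023, §2.1 Def. 2.4 and §2.2 (|t − RN(t)| ≤ ½ulp);
Shewchuk1997, §2.1 p. 308 (exact rounding)] -/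
theorem abs_sub_fl_lt_two_pow_inv_mul_abs (hp : 1 ≤ p) (hfl : IsRoundNearest p emin fl) {s : ℚ}
    (hs : OnGrid emin s) (hs0 : s ≠ 0) : |s - fl s| < ((2 : ℚ) ^ p)⁻¹ * |s| := by
  have hF : IsFloat p emin (fl s) := (hfl s).1
  have hhalf := abs_sub_fl_le_half_ulp hp hfl s
  have hspos : 0 < |s| := abs_pos.mpr hs0
  have h2p : (2 : ℚ) ^ p = 2 * 2 ^ (p - 1) := by
    rw [← pow_succ']; congr 1; omega
  by_cases hn : (2 : ℚ) ^ (emin + p - 1) ≤ |s|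
  · -- normal range
    have hulp := ulp_le_of_normal hp hn
    have hle : |s - fl s| ≤ ((2 : ℚ) ^ p)⁻¹ * |s| := by
      calc |s - fl s| ≤ ulp p emin s / 2 := hhalf
        _ ≤ |s| / 2 ^ (p - 1) / 2 := by linarith
        _ = ((2 : ℚ) ^ p)⁻¹ * |s| := by rw [h2p]; field_simp
    rcases hle.lt_or_eq with hlt | heq
    · exact hlt
    · exfalso
      -- equality forces `ulp(s) = |s| / 2^(p-1)`
      have hu : ulp p emin s = |s| / 2 ^ (p - 1) := by
        refine le_antisymm hulp ?_
        have : |s| / 2 ^ (p - 1) = 2 * (((2 : ℚ) ^ p)⁻¹ * |s|) := by rw [h2p]; field_simp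
        rw [this]; linarith
      obtain ⟨k, hk, hku⟩ := exists_ulp_eq_two_zpow (p := p) (emin := emin) s
      have hsabs : |s| = 2 ^ (p - 1) * (2 : ℚ) ^ k := by
        rw [← hku, hu]; field_simp
      have hM : |((2 : ℤ) ^ (p - 1))| < 2 ^ p := by
        rw [abs_of_pos (by positivity)]; exact pow_lt_pow_right₀ (by norm_num) (by omega)
      have hsF : IsFloat p emin s := by
        rcases (abs_eq (mul_nonneg (pow_nonneg zero_le_two _)
          (zpow_pos (by norm_num : (0 : ℚ) < 2) k).le)).mp hsabs with h | h
        · exact ⟨2 ^ (p - 1), k, hM, hk, by rw [h]; push_cast; ring⟩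
        · exact ⟨-(2 ^ (p - 1)), k, by rw [abs_neg]; exact hM, hk, by rw [h]; push_cast; ring⟩
      rw [fl_eq_self hfl hsF, sub_self, abs_zero] at heq
      have : ((2 : ℚ) ^ p)⁻¹ * |s| > 0 := mul_pos (by positivity) hspos
      linarith
  · -- subnormal range: `ulp(s) = 2^emin` and the error is a multiple of `2^emin`
    push Not at hn
    have hulp := ulp_eq_of_abs_lt (p := p) (emin := emin) hn
    have hgrid : OnGrid emin (s - fl s) := hs.sub (OnGrid.of_isFloat hF)
    have hzero : s - fl s = 0 := by
      by_contra h0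
      have hge := hgrid.two_zpow_le_abs h0
      rw [hulp] at hhalf
      linarith [zpow_pos (by norm_num : (0 : ℚ) < 2) emin]
    rw [hzero, abs_zero]
    exact mul_pos (by positivity) hspos

/-- **Absorption implies the relative reading.**  For floats `L`, `t` of `F(p, emin)` with
`fl(L + t) = L` (any round-to-nearest, any tie rule) and `L + t ≠ 0`:
`|(L + t) − L| < 2^-p·|L + t|`. [cite: Shewchuk1997, §2.7 p. 333 (conjecture, relative form);
BoldoEtAl2023, §2.2] -/
theorem rel_lt_of_fl_add_eq (hp : 1 ≤ p) (hfl : IsRoundNearest p emin fl) {L t : ℚ}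
    (hL : IsFloat p emin L) (ht : IsFloat p emin t) (h : fl (L + t) = L) (h0 : L + t ≠ 0) :
    |(L + t) - L| < ((2 : ℚ) ^ p)⁻¹ * |L + t| := by
  have := abs_sub_fl_lt_two_pow_inv_mul_abs hp hfl
    ((OnGrid.of_isFloat hL).add (OnGrid.of_isFloat ht)) h0
  rwa [h] at this

/-- **The incompressible two-component expansions, exactly** (any tie rule, `p ≥ 1`).  For floats
`t`, `L` with `|t| ≤ |L|`, COMPRESS returns `⟨t, L⟩` unchanged iff the larger absorbs the smaller,
`fl(L + t) = L`, and `t ≠ 0`: replay the two traversals — FAST-TWO-SUM is exact (Theorem 6), so the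
downward step yields `(fl(L + t), L + t − fl(L + t))` and the upward step recombines the same two
numbers. [cite: Shewchuk1997, §2.7 p. 332 (COMPRESS), §2.3 Theorem 6 (FAST-TWO-SUM)] -/
theorem compress_pair_eq_self_iff (hp : 1 ≤ p) (hfl : IsRoundNearest p emin fl) {t L : ℚ}
    (ht : IsFloat p emin t) (hL : IsFloat p emin L) (htL : |t| ≤ |L|) :
    compress fl [t, L] = [t, L] ↔ fl (L + t) = L ∧ t ≠ 0 := by
  obtain ⟨-, -, -, hsq⟩ := fastTwoSum_exact hp hfl hL ht htL
  constructor
  · intro hfix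
    by_cases hq : (fastTwoSum fl L t).2 = 0
    · exfalso
      have hc : compress fl [t, L] = [(fastTwoSum fl L t).1] := by
        simp [compress, compressDown_cons_of_eq_zero hq]
      rw [hc] at hfix
      simp at hfix
    · have hc : compress fl [t, L] =
          compressUp fl (fastTwoSum fl L t).2 [(fastTwoSum fl L t).1] := by
        simp [compress, compressDown_cons_of_ne_zero hq]
      by_cases hq2 : (fastTwoSum fl (fastTwoSum fl L t).1 (fastTwoSum fl L t).2).2 = 0
      · exfalso
        rw [hc, compressUp_cons_of_eq_zero hq2, compressUp_nil] at hfix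
        simp at hfix
      · rw [hc, compressUp_cons_of_ne_zero hq2, compressUp_nil] at hfix
        have hq'' : (fastTwoSum fl (fastTwoSum fl L t).1 (fastTwoSum fl L t).2).2 = t := by
          have := congrArg List.head? hfix
          simpa using this
        have hs' : (fastTwoSum fl (fastTwoSum fl L t).1 (fastTwoSum fl L t).2).1 = L := by
          have := congrArg List.tail hfix
          simpa using this
        have key : fl ((fastTwoSum fl L t).1 + (fastTwoSum fl L t).2) = L := hs'
        rw [hsq] at key
        exact ⟨key, hq'' ▸ hq2⟩
  · rintro ⟨h, ht0⟩
    have fl0 : fl 0 = 0 := fl_eq_self hfl (isFloat_zero p emin)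
    have hF : fastTwoSum fl L t = (L, t) := by
      simp only [fastTwoSum, h, sub_self, fl0, sub_zero, fl_eq_self hfl ht]
    have hq : (fastTwoSum fl L t).2 ≠ 0 := by rw [hF]; exact ht0
    have hc : compress fl [t, L] =
        compressUp fl (fastTwoSum fl L t).2 [(fastTwoSum fl L t).1] := by
      simp [compress, compressDown_cons_of_ne_zero hq]
    rw [hc, hF, compressUp_cons_of_ne_zero hq, compressUp_nil, hF]

/-- **Every incompressible two-component expansion satisfies the relative reading** (any tie rule,
`p ≥ 1`): if `t`, `L` are floats with `|t| ≤ |L|`, `t + L ≠ 0`, and COMPRESS returns `⟨t, L⟩`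
unchanged, then `|(t + L) − L| < 2^-p·|t + L|`.  So a counterexample to the relative reading needs at
least three components (the ties-to-away ones have four). [cite: Shewchuk1997, §2.7 p. 333
(conjecture), §2.3 Theorem 6] -/
theorem compress_pair_fixed_rel_lt (hp : 1 ≤ p) (hfl : IsRoundNearest p emin fl) {t L : ℚ}
    (ht : IsFloat p emin t) (hL : IsFloat p emin L) (htL : |t| ≤ |L|)
    (hfix : compress fl [t, L] = [t, L]) (h0 : t + L ≠ 0) :
    |(t + L) - L| < ((2 : ℚ) ^ p)⁻¹ * |t + L| := by
  have key := ((compress_pair_eq_self_iff hp hfl ht hL htL).mp hfix).1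
  rw [add_comm t L]
  exact rel_lt_of_fl_add_eq hp hfl hL ht key (by rwa [add_comm])

end Summit.Ventures.CertifiedArithmetic.Expansions
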